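import Mathlib
import Summits.ResolutionOfSingularities.ResolutionOfSingularities.Theorems.RadicialJungCleanModelsStubFrobeniusTwist
import Summits.ResolutionOfSingularities.ResolutionOfSingularities.Theorems.RadicialJungCleanModelsL1AdjoinRoot
import HarnessLib

/-!
# Crux stmt-ResolutionOfSingularities-15917 (`RadicialJung.CleanModels`), skeleton `Sketch` rev 13, stub `stub_cleanPatching3`:
# TWISTING non-trivial representatives of the `K^p`-line

The reductions of the line speak of NON-TRIVIAL REPRESENTATIVES `x = Σ_{j<p} c_j^p g₀^j` (`c : Fin p → K`, some `c_j ≠ 0`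
with `j ≠ 0`) of the `K^p`-line of a radicand `g₀ ∈ K ∖ K^p` (these are exactly the `p`-th powers of the elements of
`L = K(g₀^{1/p})` not in `K`).  The generisation lemma of the line (`stub_looseGenerises`,
`RadicialJungCleanModelsGenerisation.lean`) replaces a representative `x` by a TWIST `e^p x^α - d^p` (`e ≠ 0`, `p ∤ α`);
the patching stub needs to know that such a twist is again a non-trivial representative.  This file proves it:

* `exists_rep_of_not_mem_range` — in `L = K[X]/(X^p - g₀)`, every `y ∉ K` has `y^p = Σ c_j^p g₀^j` with some `c_j ≠ 0`,
  `j ≠ 0` (read `y` in the power basis `1, x, …, x^{p-1}`);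
* `nonTrivRep_twist` — if `x` is a non-trivial representative, so is `e^p x^α - d^p` for `e ≠ 0` and `α` prime to `p`
  (`x = y^p` with `y ∉ K` by `stub_frobeniusTwist`; `e y^α - d ∉ K` by Bézout `α s + p t = 1`; then read `(e y^α - d)` in the
  power basis).

Pure field algebra (Mathlib + two landed files of the line); lead `res-B-lead-1` g0, 2026-08-28.  Nothing here proves resolution
in characteristic `p`.
-/

noncomputable section

set_option linter.dupNamespace false

open Polynomial

namespace Summit.ResolutionOfSingularities.ResolutionOfSingularities.Theorems.RadicialJung.CleanModels

/-- In the radicial extension `L = K[X]/(X^p - g₀)` (`g₀ ∉ K^p`, so `L` is a field of degree `p`), every element `y ∉ K`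
has `y^p = Σ_{j<p} c_j^p g₀^j` with a coefficient `c_j ≠ 0` for some `j ≠ 0`: write `y = Σ c_j x^j` in the power basis and
raise to the `p`-th power. [folklore] -/
theorem exists_rep_of_not_mem_range {K : Type*} [Field K] (p : ℕ) [hp : Fact p.Prime] [CharP K p] (g₀ : K)
    (y : AdjoinRoot (X ^ p - C g₀ : K[X]))
    (hy : y ∉ Set.range (algebraMap K (AdjoinRoot (X ^ p - C g₀ : K[X])))) :
    ∃ c : Fin p → K, (∃ j : Fin p, (j : ℕ) ≠ 0 ∧ c j ≠ 0) ∧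
      algebraMap K (AdjoinRoot (X ^ p - C g₀ : K[X])) (∑ j : Fin p, c j ^ p * g₀ ^ (j : ℕ)) = y ^ p := by
  classical
  haveI : CharP (AdjoinRoot (X ^ p - C g₀ : K[X])) p :=
    charP_of_injective_algebraMap (AdjoinRootFrame.algebraMap_injective p g₀) p
  haveI : ExpChar (AdjoinRoot (X ^ p - C g₀ : K[X])) p := ExpChar.prime hp.out
  let pb := AdjoinRoot.powerBasis' (AdjoinRootFrame.monic p g₀)
  have hdim : pb.dim = p := AdjoinRootFrame.dim_eq p g₀
  -- coordinates of `y`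
  let c : Fin p → K := fun j => pb.basis.repr y (Fin.cast hdim.symm j)
  have hyc : y = ∑ j : Fin p, algebraMap K (AdjoinRoot (X ^ p - C g₀ : K[X])) (c j) *
      AdjoinRoot.root (X ^ p - C g₀ : K[X]) ^ (j : ℕ) := by
    have h := pb.basis.sum_repr y
    rw [PowerBasis.coe_basis, AdjoinRoot.powerBasis'_gen] at h
    rw [← h]
    rw [← (finCongr hdim).sum_comp]
    refine Finset.sum_congr rfl fun i _ => ?_
    simp only [c, Algebra.smul_def, finCongr_apply, Fin.val_cast]
    rfl
  refine ⟨c, ?_, ?_⟩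
  · -- non-triviality: otherwise `y = c₀ ∈ K`
    by_contra hall
    push Not at hall
    apply hy
    refine ⟨c ⟨0, hp.out.pos⟩, ?_⟩
    rw [hyc, Finset.sum_eq_single ⟨0, hp.out.pos⟩]
    · simp
    · intro j _ hj
      have : c j = 0 := by
        by_contra hne
        exact hj (Fin.ext (by
          have := hall j
          by_contra h0
          exact hne (this h0)))
      rw [this, map_zero, zero_mul]
    · intro h; exact absurd (Finset.mem_univ _) h
  · -- `y^p = Σ c_j^p g₀^j`
    rw [hyc, sum_pow_char p, map_sum]
    refine Finset.sum_congr rfl fun j _ => ?_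
    rw [map_mul, map_pow, map_pow, AdjoinRootFrame.root_pow p g₀, mul_pow, ← pow_mul, ← pow_mul, mul_comm p (j : ℕ)]

/-- **Twists of non-trivial representatives are non-trivial representatives.**  Let `K` be a field of characteristic `p`,
`g₀ ∈ K ∖ K^p`, and `x = Σ_{j<p} c_j^p g₀^j` with some `c_j ≠ 0`, `j ≠ 0`.  For `e ∈ K^×`, `d ∈ K` and `α` prime to `p`, the
twist `e^p x^α - d^p` is again of this form. (`x = y^p` for some `y ∈ L ∖ K`, `L = K(g₀^{1/p})`; `e y^α - d ∉ K` since
`y = (y^α)^s (y^p)^t` for `α s + p t = 1`; expand `e y^α - d` in the power basis.) [folklore] -/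
theorem nonTrivRep_twist {K : Type*} [Field K] (p : ℕ) [hp : Fact p.Prime] [CharP K p] (g₀ : K)
    (hg₀ : ∀ b : K, b ^ p ≠ g₀) (c : Fin p → K) (hc : ∃ j : Fin p, (j : ℕ) ≠ 0 ∧ c j ≠ 0)
    (α : ℕ) (hα : α.Coprime p) (e d : K) (he : e ≠ 0) :
    ∃ c' : Fin p → K, (∃ j : Fin p, (j : ℕ) ≠ 0 ∧ c' j ≠ 0) ∧
      (∑ j : Fin p, c' j ^ p * g₀ ^ (j : ℕ)) = e ^ p * (∑ j : Fin p, c j ^ p * g₀ ^ (j : ℕ)) ^ α - d ^ p := by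
  classical
  haveI : Fact (Irreducible (X ^ p - C g₀ : K[X])) := ⟨X_pow_sub_C_irreducible_of_prime hp.out hg₀⟩
  let L := AdjoinRoot (X ^ p - C g₀ : K[X])
  have hinj : Function.Injective (algebraMap K L) := (algebraMap K L).injective
  haveI : CharP L p := charP_of_injective_algebraMap hinj p
  set y₀ : L := AdjoinRoot.root (X ^ p - C g₀ : K[X])
  have hy₀p : algebraMap K L g₀ = y₀ ^ p := AdjoinRootFrame.root_pow p g₀
  have hy₀ : y₀ ∉ Set.range (algebraMap K L) := by
    rintro ⟨k, hk⟩
    apply hg₀ k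
    apply hinj
    rw [map_pow, hk, hy₀p]
  -- `x = y^p` with `y ∉ K`
  obtain ⟨j₀, hj₀, hcj₀⟩ := hc
  obtain ⟨y, hyK, hyp⟩ := stub_frobeniusTwist (K := K) (L := L) p hp.out y₀ g₀ hy₀ hy₀p c j₀ hj₀ hcj₀ 1 one_ne_zero 0
    zero_le_one
  rw [one_pow, one_mul, Nat.cast_zero, add_zero] at hyp
  have hy0 : y ≠ 0 := by
    rintro rfl; exact hyK ⟨0, by rw [map_zero]⟩
  -- the twisted root `e y^α - d` is not in `K`
  set y₂ : L := algebraMap K L e * y ^ α - algebraMap K L d with hy₂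
  have hy₂K : y₂ ∉ Set.range (algebraMap K L) := by
    rintro ⟨k, hk⟩
    -- then `y^α ∈ K`
    have hα' : y ^ α = algebraMap K L ((k + d) / e) := by
      rw [map_div₀, map_add, hk, hy₂, sub_add_cancel, mul_comm, mul_div_assoc,
        div_self ((_root_.map_ne_zero _).mpr he), mul_one]
    -- Bézout: `y = (y^α)^s * (y^p)^t ∈ K`
    apply hyK
    have hcop : IsCoprime (α : ℤ) (p : ℤ) := Nat.isCoprime_iff_coprime.mpr hα
    obtain ⟨s, t, hst⟩ := hcop
    refine ⟨((k + d) / e) ^ s * (∑ j : Fin p, c j ^ p * g₀ ^ (j : ℕ)) ^ t, ?_⟩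
    rw [map_mul, map_zpow₀, map_zpow₀, ← hα', hyp, ← zpow_natCast, ← zpow_natCast, ← zpow_mul, ← zpow_mul,
      ← zpow_add₀ hy0, mul_comm (α : ℤ) s, mul_comm (p : ℤ) t, hst, zpow_one]
  -- its `p`-th power is the twist
  have hy₂p : y₂ ^ p = algebraMap K L (e ^ p * (∑ j : Fin p, c j ^ p * g₀ ^ (j : ℕ)) ^ α - d ^ p) := by
    rw [hy₂, sub_pow_char, mul_pow, ← pow_mul, mul_comm α p, pow_mul, ← hyp, map_sub, map_mul, map_pow, map_pow,
      map_pow]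
  -- read `y₂` in the power basis
  obtain ⟨c', hc', hrep⟩ := exists_rep_of_not_mem_range p g₀ y₂ hy₂K
  refine ⟨c', hc', hinj ?_⟩
  rw [hrep, hy₂p]

end Summit.ResolutionOfSingularities.ResolutionOfSingularities.Theorems.RadicialJung.CleanModels

end
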